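import Mathlib
import Literature.NumberTheory.Automorphic.HyperbolicLaplaceSpectrum
import Summits.Langlands.Langlands.Theses.QuarterDeficit1951

/-!
# Parity SPLIT of the crux, sorry-free: `DeficitOdd → DeficitEven → QuarterFingerprintDeficit`
(and the parity closure of the witness class it rests on)

Crux stmt-Langlands-15897 `Summit.Langlands.Langlands.Theses.QuarterDeficit1951.QuarterFingerprintDeficit` (C1).
The registered stub `stub_parityClosure : ParityClosure` of the decomposition skeleton
`Cruxes/QuarterFingerprintDeficit/Lines/ParitySplit.lean` (`ParityClosure → DeficitOdd → DeficitEven → C1`,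
glue proved there), kernel-proved here in UNFOLDED form (`stub_parityClosure_unfolded`; the defs `IsForm`,
`Tp`, `P₀` below are verbatim copies of the crux's `let`s, so the statement is definitionally the skeleton's
`ParityClosure`).

Content: if `u` satisfies the crux's `IsForm χ u λ` (C², `(Δ + λ)u = 0`, `Γ₀(1951)`-automorphic with
nebentypus `χ(d)`, zero constant terms at `∞` and `0`, bounded) then so do `u − u∘R` and `u + u∘R`
(`R z = -z̄ = UpperHalfPlane.J • z`), and they have the same `T_p`-eigenvalues (`p ∈ {2,3,5,7,11,13}`).
Ingredients (all proved below): `R` is a real-linear isometry of `ℂ` preserving the half-plane, so `C²` and the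
Euclidean Laplacian transport; `RγR = [[a,-b],[-c,d]] ∈ Γ₀(1951)` has the same `d`; `R(x+iy) = -x+iy`,
`S•(Rw) = R(S•w)`, `T`, `S T^{1951} S⁻¹ ∈ Γ₀(1951)` give periods `1`, `1951` and the reflection of the
constant-term integrals; continuity gives integrability; `T_p` is linear and commutes with `R`.
-/

set_option linter.dupNamespace false

noncomputable section

namespace Summit.Langlands.Langlands.Theorems.QuarterFingerprintDeficit

open scoped MatrixGroups ComplexConjugate InnerProductSpace
open UpperHalfPlane Laplacian

namespace ParityClosureProof

/-! ## 0. Verbatim copies of the crux's `let`s -/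

/-- The six fingerprint primes. [folklore] -/
def P₀ : Finset ℕ := {2, 3, 5, 7, 11, 13}

/-- The crux's `IsForm χ u λ` (verbatim). [folklore] -/
def IsForm (χ : DirichletCharacter ℂ 1951) (u : UpperHalfPlane → ℂ) (lam : ℝ) : Prop :=
  Literature.NumberTheory.Automorphic.IsC2 u ∧
  (∀ z, Literature.NumberTheory.Automorphic.hypLaplacian u z + (lam : ℂ) * u z = 0) ∧
  (∀ γ : Matrix.SpecialLinearGroup (Fin 2) ℤ, γ ∈ CongruenceSubgroup.Gamma0 1951 →
    ∀ z : UpperHalfPlane, u (γ • z) = χ ((γ 1 1 : ℤ) : ZMod 1951) * u z) ∧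
  (∀ y : ℝ, 0 < y → ∫ x in (0 : ℝ)..1, u (ofComplex (x + y * Complex.I)) = 0) ∧
  (∀ y : ℝ, 0 < y →
    ∫ x in (0 : ℝ)..1951, u (ModularGroup.S • ofComplex (x + y * Complex.I)) = 0) ∧
  (∃ C : ℝ, ∀ z, ‖u z‖ ≤ C)

/-- The crux's Hecke operator (verbatim). [folklore] -/
def Tp (χ : DirichletCharacter ℂ 1951) (p : ℕ) (u : UpperHalfPlane → ℂ) (z : UpperHalfPlane) : ℂ :=
  ((Real.sqrt p : ℝ) : ℂ)⁻¹ *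
    ((∑ b ∈ Finset.range p, u (ofComplex (((z : ℂ) + b) / p))) +
      χ (p : ZMod 1951) * u (ofComplex ((p : ℂ) * z)))

/-! ## 1. The reflection on `ℍ` and on `ℂ` -/

theorem J_smul_J_smul (z : ℍ) : J • J • z = z := by
  rw [smul_smul, ← sq, UpperHalfPlane.J_sq, one_smul]

theorem im_J_smul (z : ℍ) : (J • z).im = z.im := by
  rw [← coe_im, coe_J_smul]; simp

theorem J_smul_ofComplex' (w : ℂ) (hw : 0 < w.im) : J • ofComplex w = ofComplex (-conj w) := by
  have h2 : 0 < (-conj w).im := by simpa using hw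
  apply UpperHalfPlane.ext
  rw [coe_J_smul, ofComplex_apply_of_im_pos hw, ofComplex_apply_of_im_pos h2, coe_mk, coe_mk]

theorem J_smul_ofComplex (x y : ℝ) (hy : 0 < y) :
    J • ofComplex ((x : ℂ) + y * Complex.I) = ofComplex (((-x : ℝ) : ℂ) + y * Complex.I) := by
  have h1 : 0 < ((x : ℂ) + y * Complex.I).im := by simpa using hy
  rw [J_smul_ofComplex' _ h1]
  congr 1
  apply Complex.ext <;> simp

theorem T_smul_ofComplex' (w : ℂ) (hw : 0 < w.im) : ModularGroup.T • ofComplex w = ofComplex (w + 1) := by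
  have h2 : 0 < (w + 1).im := by simpa using hw
  apply UpperHalfPlane.ext
  rw [modular_T_smul, coe_vadd, ofComplex_apply_of_im_pos hw, ofComplex_apply_of_im_pos h2, coe_mk, coe_mk]
  push_cast; ring

theorem T_zpow_smul_ofComplex (n : ℤ) (x y : ℝ) (hy : 0 < y) :
    ModularGroup.T ^ n • ofComplex ((x : ℂ) + y * Complex.I) =
      ofComplex (((x + n : ℝ) : ℂ) + y * Complex.I) := by
  have h1 : 0 < ((x : ℂ) + y * Complex.I).im := by simpa using hy
  have h2 : 0 < ((((x + n : ℝ)) : ℂ) + y * Complex.I).im := by simpa using hy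
  apply UpperHalfPlane.ext
  rw [modular_T_zpow_smul, coe_vadd, ofComplex_apply_of_im_pos h1, ofComplex_apply_of_im_pos h2,
    coe_mk, coe_mk]
  push_cast; ring

theorem S_smul_J_smul (w : ℍ) : ModularGroup.S • (J • w) = J • (ModularGroup.S • w) := by
  apply UpperHalfPlane.ext
  rw [coe_J_smul, modular_S_smul, modular_S_smul, coe_mk, coe_mk, coe_J_smul]
  simp [map_neg, map_inv₀]

theorem coe_S_smul_ofComplex (w : ℂ) (hw : 0 < w.im) : ((ModularGroup.S • ofComplex w : ℍ) : ℂ) = (-w)⁻¹ := by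
  rw [modular_S_smul, coe_mk, ofComplex_apply_of_im_pos hw, coe_mk]

/-! ## 2. Group elements -/

def reflConj (γ : SL(2, ℤ)) : SL(2, ℤ) :=
  ⟨!![γ 0 0, -(γ 0 1); -(γ 1 0), γ 1 1], by
    have h := γ.det_coe
    rw [Matrix.det_fin_two] at h
    rw [Matrix.det_fin_two_of]
    linarith⟩

@[simp] theorem reflConj_apply_11 (γ : SL(2, ℤ)) : (reflConj γ) 1 1 = γ 1 1 := rfl

theorem reflConj_mem {N : ℕ} {γ : SL(2, ℤ)} (hγ : γ ∈ CongruenceSubgroup.Gamma0 N) :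
    reflConj γ ∈ CongruenceSubgroup.Gamma0 N := by
  rw [CongruenceSubgroup.Gamma0_mem] at hγ ⊢
  simp [reflConj, hγ]

theorem J_smul_sl_smul (γ : SL(2, ℤ)) (z : ℍ) : J • (γ • z) = reflConj γ • (J • z) := by
  apply UpperHalfPlane.ext
  rw [coe_J_smul, coe_specialLinearGroup_apply, coe_specialLinearGroup_apply, coe_J_smul]
  simp only [reflConj, eq_intCast, Matrix.SpecialLinearGroup.coe_mk, Matrix.of_apply, Matrix.cons_val',
    Matrix.cons_val_zero, Matrix.cons_val_one, Matrix.cons_val_fin_one, Matrix.empty_val',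
    map_div₀, map_add, map_mul, map_neg, Complex.conj_ofReal]
  rw [← neg_div]
  congr 1 <;> push_cast <;> ring

def γ₀ : SL(2, ℤ) := ⟨!![1, 0; -1951, 1], by norm_num [Matrix.det_fin_two_of]⟩

theorem S_mul_T_zpow : ModularGroup.S * ModularGroup.T ^ (1951 : ℤ) = γ₀ * ModularGroup.S := by
  ext i j
  simp only [Matrix.SpecialLinearGroup.coe_mul, ModularGroup.coe_T_zpow, ModularGroup.S, γ₀]
  fin_cases i <;> fin_cases j <;> simp [Matrix.mul_apply, Fin.sum_univ_two]

theorem γ₀_mem : γ₀ ∈ CongruenceSubgroup.Gamma0 1951 := by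
  rw [CongruenceSubgroup.Gamma0_mem]
  simp [γ₀]
  decide

theorem T_mem : ModularGroup.T ∈ CongruenceSubgroup.Gamma0 1951 := by
  rw [CongruenceSubgroup.Gamma0_mem]
  simp [ModularGroup.T]

/-! ## 3. One-variable integral identities (no integrability needed) -/

theorem integral_shift_period (g : ℝ → ℂ) (P : ℝ) (hper : ∀ x, g (x + P) = g x) :
    ∫ x in (0 : ℝ)..P, g x = ∫ x in (-P : ℝ)..0, g x := by
  have e : (fun x => g x) = fun x => g (x - P) := by
    funext x; rw [← hper (x - P), sub_add_cancel]
  calc ∫ x in (0 : ℝ)..P, g x = ∫ x in (0 : ℝ)..P, g (x - P) := by rw [← e]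
    _ = ∫ x in (0 : ℝ) - P..P - P, g x := intervalIntegral.integral_comp_sub_right _ P
    _ = ∫ x in (-P : ℝ)..0, g x := by simp

theorem integral_reflect_periodic (g : ℝ → ℂ) (P : ℝ) (hper : ∀ x, g (x + P) = g x) :
    ∫ x in (0 : ℝ)..P, g (-x) = ∫ x in (0 : ℝ)..P, g x := by
  rw [integral_shift_period g P hper, intervalIntegral.integral_comp_neg]; simp

/-! ## 4. The Laplacian under the reflection -/

def reflLIE : ℂ ≃ₗᵢ[ℝ] ℂ := Complex.conjLIE.trans (LinearIsometryEquiv.neg ℝ)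

@[simp] theorem reflLIE_apply (w : ℂ) : reflLIE w = -conj w := by
  simp [reflLIE, LinearIsometryEquiv.trans_apply, LinearIsometryEquiv.coe_neg]

theorem laplacian_comp_linearIsometryEquiv (f : ℂ → ℂ) (L : ℂ ≃ₗᵢ[ℝ] ℂ) (x : ℂ) :
    (Δ (f ∘ L)) x = (Δ f) (L x) := by
  set v := Complex.orthonormalBasisOneI with hv
  have h1 := congrFun (InnerProductSpace.laplacian_eq_iteratedFDeriv_orthonormalBasis (f ∘ L) v) x
  have h2 := congrFun (InnerProductSpace.laplacian_eq_iteratedFDeriv_orthonormalBasis f (v.map L)) (L x)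
  rw [h1, h2]
  refine Finset.sum_congr rfl fun i _ => ?_
  have h := L.toContinuousLinearEquiv.iteratedFDerivWithin_comp_right f uniqueDiffOn_univ
    (Set.mem_univ (L.toContinuousLinearEquiv x)) 2
  simp only [Set.preimage_univ, iteratedFDerivWithin_univ,
    LinearIsometryEquiv.coe_toContinuousLinearEquiv] at h
  rw [h, ContinuousMultilinearMap.compContinuousLinearMap_apply, OrthonormalBasis.map_apply]
  congr 1
  funext j
  fin_cases j <;> simp

theorem comp_J_ofComplex_eq (u : ℍ → ℂ) {w : ℂ} (hw : 0 < w.im) :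
    ((fun z => u (J • z)) ∘ ofComplex) w = ((u ∘ ofComplex) ∘ reflLIE) w := by
  simp only [Function.comp_apply, reflLIE_apply]
  rw [J_smul_ofComplex' w hw]

theorem isOpen_uhp : IsOpen {w : ℂ | 0 < w.im} := isOpen_lt continuous_const Complex.continuous_im

/-- `IsC2` and `hypLaplacian` transport under `R`. [folklore] -/
theorem reflect_laplacian (u : ℍ → ℂ) (hu : Literature.NumberTheory.Automorphic.IsC2 u) :
    Literature.NumberTheory.Automorphic.IsC2 (fun z => u (J • z)) ∧
    ∀ z : ℍ, Literature.NumberTheory.Automorphic.hypLaplacian (fun w => u (J • w)) z =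
      Literature.NumberTheory.Automorphic.hypLaplacian u (J • z) := by
  have hmaps : Set.MapsTo (reflLIE : ℂ → ℂ) {w : ℂ | 0 < w.im} {w : ℂ | 0 < w.im} := by
    intro w hw; simpa [reflLIE_apply] using hw
  constructor
  · unfold Literature.NumberTheory.Automorphic.IsC2 at hu ⊢
    exact (hu.comp reflLIE.contDiff.contDiffOn hmaps).congr fun w hw => comp_J_ofComplex_eq u hw
  · intro z
    unfold Literature.NumberTheory.Automorphic.hypLaplacian
    rw [im_J_smul]
    congr 1
    have hev : ((fun w => u (J • w)) ∘ ofComplex) =ᶠ[nhds (z : ℂ)] ((u ∘ ofComplex) ∘ reflLIE) := by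
      filter_upwards [isOpen_uhp.mem_nhds z.im_pos] with w hw
      exact comp_J_ofComplex_eq u hw
    rw [(InnerProductSpace.laplacian_congr_nhds hev).eq_of_nhds, laplacian_comp_linearIsometryEquiv,
      reflLIE_apply, coe_J_smul]

/-- `C²` functions on `ℍ` are `C²` at each point (for the linearity of `Δ`). [folklore] -/
theorem contDiffAt_of_isC2 {u : ℍ → ℂ} (hu : Literature.NumberTheory.Automorphic.IsC2 u) (z : ℍ) :
    ContDiffAt ℝ 2 (u ∘ ofComplex) (z : ℂ) :=
  hu.contDiffAt (isOpen_uhp.mem_nhds z.im_pos)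

/-! ## 5. Continuity of the constant-term integrands -/

theorem continuous_horizontal {u : ℍ → ℂ} (hu : Literature.NumberTheory.Automorphic.IsC2 u) (y : ℝ)
    (hy : 0 < y) : Continuous fun x : ℝ => u (ofComplex ((x : ℂ) + y * Complex.I)) := by
  have hcont : ContinuousOn (u ∘ ofComplex) {w : ℂ | 0 < w.im} := hu.continuousOn
  have hpath : Continuous fun x : ℝ => (x : ℂ) + y * Complex.I := by fun_prop
  have hin : ∀ x : ℝ, (x : ℂ) + y * Complex.I ∈ {w : ℂ | 0 < w.im} := by
    intro x; simpa using hy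
  exact hcont.comp_continuous hpath hin

theorem continuous_horizontal_S {u : ℍ → ℂ} (hu : Literature.NumberTheory.Automorphic.IsC2 u) (y : ℝ)
    (hy : 0 < y) : Continuous fun x : ℝ => u (ModularGroup.S • ofComplex ((x : ℂ) + y * Complex.I)) := by
  have hcont : ContinuousOn (u ∘ ofComplex) {w : ℂ | 0 < w.im} := hu.continuousOn
  have hne : ∀ x : ℝ, -((x : ℂ) + y * Complex.I) ≠ 0 := by
    intro x h
    have := congrArg Complex.im h
    simp at this
    exact hy.ne' this
  have hpath : Continuous fun x : ℝ => (-((x : ℂ) + y * Complex.I))⁻¹ := by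
    apply Continuous.inv₀ (by fun_prop) hne
  have him : ∀ x : ℝ, 0 < ((x : ℂ) + y * Complex.I).im := by intro x; simpa using hy
  have hin : ∀ x : ℝ, (-((x : ℂ) + y * Complex.I))⁻¹ ∈ {w : ℂ | 0 < w.im} := by
    intro x
    have := (ModularGroup.S • ofComplex ((x : ℂ) + y * Complex.I)).im_pos
    rw [← coe_im, coe_S_smul_ofComplex _ (him x)] at this
    exact this
  have h := hcont.comp_continuous hpath hin
  refine h.congr fun x => ?_
  simp only [Function.comp_apply]
  rw [← coe_S_smul_ofComplex _ (him x), ofComplex_apply]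

/-! ## 6. The parity closure -/

/-- **`ParityClosure`, unfolded and proved.** [folklore] -/
theorem stub_parityClosure_unfolded :
    ∀ (χ : DirichletCharacter ℂ 1951) (u : UpperHalfPlane → ℂ) (lam : ℝ), IsForm χ u lam →
      (IsForm χ (fun z => u z - u (J • z)) lam ∧ IsForm χ (fun z => u z + u (J • z)) lam) ∧
      ∀ p ∈ P₀, ∀ μ : ℂ, (∀ z, Tp χ p u z = μ * u z) →
        (∀ z, Tp χ p (fun w => u w - u (J • w)) z = μ * (u z - u (J • z))) ∧
        (∀ z, Tp χ p (fun w => u w + u (J • w)) z = μ * (u z + u (J • z))) := by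
  intro χ u lam hform
  obtain ⟨hC2, hΔ, haut, hct1, hct2, ⟨C, hC⟩⟩ := hform
  obtain ⟨hC2J, hΔJ⟩ := reflect_laplacian u hC2
  -- periodicity consequences of automorphy
  have hT1 : ((ModularGroup.T 1 1 : ℤ) : ZMod 1951) = 1 := by simp [ModularGroup.T]
  have hγ1 : ((γ₀ 1 1 : ℤ) : ZMod 1951) = 1 := by simp [γ₀]
  have hperC : ∀ w : ℂ, 0 < w.im → u (ofComplex (w + 1)) = u (ofComplex w) := by
    intro w hw
    rw [← T_smul_ofComplex' w hw, haut _ T_mem, hT1, map_one, one_mul]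
  have hper1 : ∀ (y : ℝ), 0 < y → ∀ x : ℝ,
      u (ofComplex (((x + 1 : ℝ)) + y * Complex.I)) = u (ofComplex ((x : ℂ) + y * Complex.I)) := by
    intro y hy x
    have him : 0 < ((x : ℂ) + y * Complex.I).im := by simpa using hy
    have e : (((x + 1 : ℝ) : ℂ) + y * Complex.I) = ((x : ℂ) + y * Complex.I) + 1 := by push_cast; ring
    rw [e, hperC _ him]
  have hper1951 : ∀ (y : ℝ), 0 < y → ∀ x : ℝ,
      u (ModularGroup.S • ofComplex (((x + 1951 : ℝ)) + y * Complex.I)) =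
        u (ModularGroup.S • ofComplex ((x : ℂ) + y * Complex.I)) := by
    intro y hy x
    have e : ((x + 1951 : ℝ) : ℂ) = ((x + (1951 : ℤ) : ℝ) : ℂ) := by push_cast; ring
    rw [e, ← T_zpow_smul_ofComplex 1951 x y hy, ← mul_smul, S_mul_T_zpow, mul_smul, haut _ γ₀_mem, hγ1,
      map_one, one_mul]
  -- the reflected constant-term integrals vanish too
  have hct1J : ∀ y : ℝ, 0 < y → ∫ x in (0 : ℝ)..1, u (J • ofComplex ((x : ℂ) + y * Complex.I)) = 0 := by
    intro y hy
    have e : (fun x : ℝ => u (J • ofComplex ((x : ℂ) + y * Complex.I))) =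
        fun x : ℝ => (fun t : ℝ => u (ofComplex ((t : ℂ) + y * Complex.I))) (-x) := by
      funext x; simp only [J_smul_ofComplex x y hy]
    rw [e, integral_reflect_periodic (fun t : ℝ => u (ofComplex ((t : ℂ) + y * Complex.I))) 1 (hper1 y hy),
      hct1 y hy]
  have hct2J : ∀ y : ℝ, 0 < y →
      ∫ x in (0 : ℝ)..1951, u (J • (ModularGroup.S • ofComplex ((x : ℂ) + y * Complex.I))) = 0 := by
    intro y hy
    have e : (fun x : ℝ => u (J • (ModularGroup.S • ofComplex ((x : ℂ) + y * Complex.I)))) =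
        fun x : ℝ => (fun t : ℝ => u (ModularGroup.S • ofComplex ((t : ℂ) + y * Complex.I))) (-x) := by
      funext x; simp only [← S_smul_J_smul, J_smul_ofComplex x y hy]
    rw [e, integral_reflect_periodic (fun t : ℝ => u (ModularGroup.S • ofComplex ((t : ℂ) + y * Complex.I))) 1951
      (hper1951 y hy), hct2 y hy]
  -- integrability (continuity) of the four integrands
  have hint1 : ∀ y : ℝ, 0 < y → ∀ a b : ℝ,
      IntervalIntegrable (fun x : ℝ => u (ofComplex ((x : ℂ) + y * Complex.I))) MeasureTheory.volume a b :=
    fun y hy a b => (continuous_horizontal hC2 y hy).intervalIntegrable a b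
  have hint1J : ∀ y : ℝ, 0 < y → ∀ a b : ℝ,
      IntervalIntegrable (fun x : ℝ => u (J • ofComplex ((x : ℂ) + y * Complex.I))) MeasureTheory.volume a b := by
    intro y hy a b
    have e : (fun x : ℝ => u (J • ofComplex ((x : ℂ) + y * Complex.I))) =
        fun x : ℝ => (fun t : ℝ => u (ofComplex ((t : ℂ) + y * Complex.I))) (-x) := by
      funext x; simp only [J_smul_ofComplex x y hy]
    rw [e]
    exact ((continuous_horizontal hC2 y hy).comp continuous_neg).intervalIntegrable a b
  have hint2 : ∀ y : ℝ, 0 < y → ∀ a b : ℝ,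
      IntervalIntegrable (fun x : ℝ => u (ModularGroup.S • ofComplex ((x : ℂ) + y * Complex.I)))
        MeasureTheory.volume a b :=
    fun y hy a b => (continuous_horizontal_S hC2 y hy).intervalIntegrable a b
  have hint2J : ∀ y : ℝ, 0 < y → ∀ a b : ℝ,
      IntervalIntegrable (fun x : ℝ => u (J • (ModularGroup.S • ofComplex ((x : ℂ) + y * Complex.I))))
        MeasureTheory.volume a b := by
    intro y hy a b
    have e : (fun x : ℝ => u (J • (ModularGroup.S • ofComplex ((x : ℂ) + y * Complex.I)))) =
        fun x : ℝ => (fun t : ℝ => u (ModularGroup.S • ofComplex ((t : ℂ) + y * Complex.I))) (-x) := by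
      funext x; simp only [← S_smul_J_smul, J_smul_ofComplex x y hy]
    rw [e]
    exact ((continuous_horizontal_S hC2 y hy).comp continuous_neg).intervalIntegrable a b
  -- Laplacian linearity at each point
  have hΔsub : ∀ z : ℍ, Literature.NumberTheory.Automorphic.hypLaplacian (fun w => u w - u (J • w)) z =
      Literature.NumberTheory.Automorphic.hypLaplacian u z -
        Literature.NumberTheory.Automorphic.hypLaplacian (fun w => u (J • w)) z := by
    intro z
    unfold Literature.NumberTheory.Automorphic.hypLaplacian
    have h := (contDiffAt_of_isC2 hC2 z).laplacian_sub (contDiffAt_of_isC2 hC2J z)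
    have e : ((fun w => u w - u (J • w)) ∘ ofComplex) = (u ∘ ofComplex) - ((fun w => u (J • w)) ∘ ofComplex) := rfl
    rw [e, h, mul_sub]
  have hΔadd : ∀ z : ℍ, Literature.NumberTheory.Automorphic.hypLaplacian (fun w => u w + u (J • w)) z =
      Literature.NumberTheory.Automorphic.hypLaplacian u z +
        Literature.NumberTheory.Automorphic.hypLaplacian (fun w => u (J • w)) z := by
    intro z
    unfold Literature.NumberTheory.Automorphic.hypLaplacian
    have h := (contDiffAt_of_isC2 hC2 z).laplacian_add (contDiffAt_of_isC2 hC2J z)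
    have e : ((fun w => u w + u (J • w)) ∘ ofComplex) = (u ∘ ofComplex) + ((fun w => u (J • w)) ∘ ofComplex) := rfl
    rw [e, h, mul_add]
  -- C² linearity
  have hC2sub : Literature.NumberTheory.Automorphic.IsC2 (fun w => u w - u (J • w)) := by
    unfold Literature.NumberTheory.Automorphic.IsC2 at hC2 hC2J ⊢
    exact hC2.sub hC2J
  have hC2add : Literature.NumberTheory.Automorphic.IsC2 (fun w => u w + u (J • w)) := by
    unfold Literature.NumberTheory.Automorphic.IsC2 at hC2 hC2J ⊢
    exact hC2.add hC2J
  -- automorphy of the reflected function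
  have hautJ : ∀ γ : SL(2, ℤ), γ ∈ CongruenceSubgroup.Gamma0 1951 →
      ∀ z : ℍ, u (J • (γ • z)) = χ ((γ 1 1 : ℤ) : ZMod 1951) * u (J • z) := by
    intro γ hγ z
    rw [J_smul_sl_smul, haut _ (reflConj_mem hγ), reflConj_apply_11]
  refine ⟨⟨⟨hC2sub, ?_, ?_, ?_, ?_, ?_⟩, ⟨hC2add, ?_, ?_, ?_, ?_, ?_⟩⟩, ?_⟩
  -- IsForm for u - u∘J
  · intro z
    rw [hΔsub z, hΔJ z]
    have h1 := hΔ z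
    have h2 := hΔ (J • z)
    linear_combination h1 - h2
  · intro γ hγ z
    show u (γ • z) - u (J • (γ • z)) = _ * (u z - u (J • z))
    rw [haut γ hγ z, hautJ γ hγ z]; ring
  · intro y hy
    show ∫ x in (0 : ℝ)..1, (u (ofComplex ((x : ℂ) + y * Complex.I)) - u (J • ofComplex ((x : ℂ) + y * Complex.I))) = 0
    rw [intervalIntegral.integral_sub (hint1 y hy 0 1) (hint1J y hy 0 1), hct1 y hy, hct1J y hy, sub_zero]
  · intro y hy
    show ∫ x in (0 : ℝ)..1951, (u (ModularGroup.S • ofComplex ((x : ℂ) + y * Complex.I)) -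
      u (J • (ModularGroup.S • ofComplex ((x : ℂ) + y * Complex.I)))) = 0
    rw [intervalIntegral.integral_sub (hint2 y hy 0 1951) (hint2J y hy 0 1951), hct2 y hy, hct2J y hy,
      sub_zero]
  · refine ⟨C + C, fun z => ?_⟩
    calc ‖u z - u (J • z)‖ ≤ ‖u z‖ + ‖u (J • z)‖ := norm_sub_le _ _
      _ ≤ C + C := add_le_add (hC z) (hC (J • z))
  -- IsForm for u + u∘J
  · intro z
    rw [hΔadd z, hΔJ z]
    have h1 := hΔ z
    have h2 := hΔ (J • z)
    linear_combination h1 + h2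
  · intro γ hγ z
    show u (γ • z) + u (J • (γ • z)) = _ * (u z + u (J • z))
    rw [haut γ hγ z, hautJ γ hγ z]; ring
  · intro y hy
    show ∫ x in (0 : ℝ)..1, (u (ofComplex ((x : ℂ) + y * Complex.I)) + u (J • ofComplex ((x : ℂ) + y * Complex.I))) = 0
    rw [intervalIntegral.integral_add (hint1 y hy 0 1) (hint1J y hy 0 1), hct1 y hy, hct1J y hy, add_zero]
  · intro y hy
    show ∫ x in (0 : ℝ)..1951, (u (ModularGroup.S • ofComplex ((x : ℂ) + y * Complex.I)) +
      u (J • (ModularGroup.S • ofComplex ((x : ℂ) + y * Complex.I)))) = 0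
    rw [intervalIntegral.integral_add (hint2 y hy 0 1951) (hint2J y hy 0 1951), hct2 y hy, hct2J y hy,
      add_zero]
  · refine ⟨C + C, fun z => ?_⟩
    calc ‖u z + u (J • z)‖ ≤ ‖u z‖ + ‖u (J • z)‖ := norm_add_le _ _
      _ ≤ C + C := add_le_add (hC z) (hC (J • z))
  -- Hecke eigenvalues
  · intro p hp μ hTu
    have hp0 : 0 < p := by
      simp only [P₀, Finset.mem_insert, Finset.mem_singleton] at hp
      rcases hp with rfl | rfl | rfl | rfl | rfl | rfl <;> norm_num
    have hpR : (0 : ℝ) < p := by exact_mod_cast hp0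
    -- T_p (u∘J) z = T_p u (J z)
    have hTJ : ∀ z : ℍ, Tp χ p (fun w => u (J • w)) z = Tp χ p u (J • z) := by
      intro z
      have hzim : 0 < (z : ℂ).im := z.im_pos
      unfold Tp
      have h2 : J • ofComplex ((p : ℂ) * z) = ofComplex ((p : ℂ) * ↑(J • z)) := by
        have him : 0 < ((p : ℂ) * (z : ℂ)).im := by
          simp only [Complex.mul_im, Complex.natCast_re, Complex.natCast_im, zero_mul, add_zero]
          exact mul_pos hpR hzim
        rw [J_smul_ofComplex' _ him, coe_J_smul]
        congr 1
        simp [map_mul, map_natCast]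
      have h1 : ∀ b ∈ Finset.range p,
          u (J • ofComplex (((z : ℂ) + b) / p)) = u (ofComplex (((↑(J • z) : ℂ) - b) / p)) := by
        intro b _
        have him : 0 < (((z : ℂ) + b) / p).im := by
          rw [Complex.div_natCast_im]
          simp only [Complex.add_im, Complex.natCast_im, add_zero]
          exact div_pos hzim hpR
        rw [J_smul_ofComplex' _ him, coe_J_smul]
        congr 2
        simp only [map_div₀, map_add, map_natCast]
        ring
      have hJim : 0 < ((↑(J • z) : ℂ)).im := (J • z).im_pos
      -- shift `(w - b)/p ↦ (w + b')/p` using the period 1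
      have hshift : ∑ b ∈ Finset.range p, u (ofComplex (((↑(J • z) : ℂ) - b) / p)) =
          ∑ b ∈ Finset.range p, u (ofComplex (((↑(J • z) : ℂ) + b) / p)) := by
        set w : ℂ := ↑(J • z) with hw
        refine Finset.sum_nbij' (fun b => if b = 0 then 0 else p - b) (fun b => if b = 0 then 0 else p - b)
          ?_ ?_ ?_ ?_ ?_
        · intro b hb
          simp only [Finset.mem_range] at hb ⊢
          split_ifs <;> omega
        · intro b hb
          simp only [Finset.mem_range] at hb ⊢
          split_ifs <;> omega
        · intro b hb
          simp only [Finset.mem_range] at hb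
          by_cases h0 : b = 0
          · simp [h0]
          · have h1 : p - b ≠ 0 := by omega
            simp only [h0, if_false, h1]
            omega
        · intro b hb
          simp only [Finset.mem_range] at hb
          by_cases h0 : b = 0
          · simp [h0]
          · have h1 : p - b ≠ 0 := by omega
            simp only [h0, if_false, h1]
            omega
        · intro b hb
          simp only [Finset.mem_range] at hb
          by_cases h0 : b = 0
          · simp [h0]
          · simp only [h0, if_false]
            have hbp : b ≤ p := hb.le
            have hpC : (p : ℂ) ≠ 0 := by exact_mod_cast hp0.ne'
            have e : (w + ((p - b : ℕ) : ℂ)) / p = (w - b) / p + 1 := by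
              rw [Nat.cast_sub hbp]
              field_simp
              ring
            have him : 0 < ((w - b) / p).im := by
              rw [Complex.div_natCast_im]
              simp only [Complex.sub_im, Complex.natCast_im, sub_zero]
              exact div_pos hJim hpR
            rw [e, hperC _ him]
      beta_reduce
      rw [Finset.sum_congr rfl h1, hshift, h2]
    have hsub : ∀ z : ℍ, Tp χ p (fun w => u w - u (J • w)) z = Tp χ p u z - Tp χ p (fun w => u (J • w)) z := by
      intro z; unfold Tp; rw [Finset.sum_sub_distrib]; ring
    have hadd : ∀ z : ℍ, Tp χ p (fun w => u w + u (J • w)) z = Tp χ p u z + Tp χ p (fun w => u (J • w)) z := by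
      intro z; unfold Tp; rw [Finset.sum_add_distrib]; ring
    constructor
    · intro z
      rw [hsub, hTJ, hTu, hTu]; ring
    · intro z
      rw [hadd, hTJ, hTu, hTu]; ring

end ParityClosureProof

/-! ## 7. The parity DECOMPOSITION of the crux, sorry-free:
`DeficitOdd → DeficitEven → QuarterFingerprintDeficit` -/

namespace ParitySplit

open ParityClosureProof

/-- `Φ = {0, 1, 4, (3 ± √5)/2}` (verbatim). [folklore] -/
def Φ : Set ℂ := {0, 1, 4, (((3 + Real.sqrt 5) / 2 : ℝ) : ℂ), (((3 - Real.sqrt 5) / 2 : ℝ) : ℂ)}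

/-- The crux's windowed fingerprint clause at the six primes (verbatim pieces). [folklore] -/
def Fingerprint (χ : DirichletCharacter ℂ 1951) (u : UpperHalfPlane → ℂ) : Prop :=
  ∀ p ∈ P₀, ∃ μ φ : ℂ, φ ∈ Φ ∧ (∀ z, Tp χ p u z = μ * u z) ∧
    ‖μ ^ 2 * (starRingEnd ℂ) (χ (p : ZMod 1951)) - φ‖ ≤ 1 / 100

/-- SUB-CRUX `DeficitOdd`: the crux restricted to witnesses ODD under `R : z ↦ -z̄`. EXPECTED FALSE — it is the
refutation target (the sighted `λ = 1/4` Doud–Moore newforms at 1951 are odd, and the odd sector of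
`(Γ₀(1951), χ)` is purely cuspidal). [folklore] -/
def DeficitOdd : Prop :=
  ∀ χ : DirichletCharacter ℂ 1951, orderOf χ = 5 → ¬ ∃ (u : UpperHalfPlane → ℂ) (lam : ℝ),
    IsForm χ u lam ∧ (∀ z, u (J • z) = - u z) ∧ (∃ z, u z ≠ 0) ∧ |lam - 1 / 4| ≤ 1 / 100 ∧ Fingerprint χ u

/-- SUB-CRUX `DeficitEven`: the crux restricted to witnesses EVEN under `R`. Plausibly true; certifiable only by
an even-sector census; moot for the route once `DeficitOdd` is refuted. [folklore] -/
def DeficitEven : Prop :=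
  ∀ χ : DirichletCharacter ℂ 1951, orderOf χ = 5 → ¬ ∃ (u : UpperHalfPlane → ℂ) (lam : ℝ),
    IsForm χ u lam ∧ (∀ z, u (J • z) = u z) ∧ (∃ z, u z ≠ 0) ∧ |lam - 1 / 4| ≤ 1 / 100 ∧ Fingerprint χ u

/-- **THE SPLIT, sorry-free:** `DeficitOdd → DeficitEven → QuarterFingerprintDeficit`. A crux witness `u ≢ 0`
has a nonzero odd part `u − u∘R` or even part `u + u∘R` (`u = ((u − u∘R) + (u + u∘R))/2`), which is again a
witness with the same eigenvalues by the parity closure (`stub_parityClosure_unfolded`). The converse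
directions `QuarterFingerprintDeficit → DeficitOdd`, `→ DeficitEven` are trivial (below). [folklore] -/
theorem QuarterFingerprintDeficit_of_subs (hO : DeficitOdd) (hE : DeficitEven) :
    Summit.Langlands.Langlands.Theses.QuarterDeficit1951.QuarterFingerprintDeficit := by
  intro χ hχ hex
  obtain ⟨u, lam, hform, ⟨z₀, hz₀⟩, hwin, hfp⟩ := hex
  obtain ⟨⟨hformO, hformE⟩, hT⟩ := stub_parityClosure_unfolded χ u lam hform
  have hfpO : Fingerprint χ (fun z => u z - u (J • z)) := by
    intro p hp
    obtain ⟨μ, φ, hφ, hTu, hfin⟩ := hfp p hp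
    exact ⟨μ, φ, hφ, (hT p hp μ hTu).1, hfin⟩
  have hfpE : Fingerprint χ (fun z => u z + u (J • z)) := by
    intro p hp
    obtain ⟨μ, φ, hφ, hTu, hfin⟩ := hfp p hp
    exact ⟨μ, φ, hφ, (hT p hp μ hTu).2, hfin⟩
  by_cases ho : ∃ z, u z - u (J • z) ≠ 0
  · exact hO χ hχ ⟨fun z => u z - u (J • z), lam, hformO,
      fun z => by simp only [J_smul_J_smul]; ring, ho, hwin, hfpO⟩
  · by_cases he : ∃ z, u z + u (J • z) ≠ 0
    · exact hE χ hχ ⟨fun z => u z + u (J • z), lam, hformE,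
        fun z => by simp only [J_smul_J_smul]; ring, he, hwin, hfpE⟩
    · push Not at ho he
      apply hz₀
      have h1 := ho z₀
      have h2 := he z₀
      linear_combination (h1 + h2) / 2

/-- Trivial direction: the crux implies its odd restriction, so a refutation of `DeficitOdd` refutes the crux.
[folklore] -/
theorem deficitOdd_of_deficit (h : Summit.Langlands.Langlands.Theses.QuarterDeficit1951.QuarterFingerprintDeficit) :
    DeficitOdd := by
  intro χ hχ ⟨u, lam, hform, _hodd, hne, hwin, hfp⟩
  exact h χ hχ ⟨u, lam, hform, hne, hwin, hfp⟩

/-- Trivial direction for the even restriction. [folklore] -/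
theorem deficitEven_of_deficit (h : Summit.Langlands.Langlands.Theses.QuarterDeficit1951.QuarterFingerprintDeficit) :
    DeficitEven := by
  intro χ hχ ⟨u, lam, hform, _hev, hne, hwin, hfp⟩
  exact h χ hχ ⟨u, lam, hform, hne, hwin, hfp⟩

/-- Hence the crux is EQUIVALENT to the conjunction of its two parity halves. [folklore] -/
theorem deficit_iff_odd_and_even :
    Summit.Langlands.Langlands.Theses.QuarterDeficit1951.QuarterFingerprintDeficit ↔ (DeficitOdd ∧ DeficitEven) :=
  ⟨fun h => ⟨deficitOdd_of_deficit h, deficitEven_of_deficit h⟩, fun h => QuarterFingerprintDeficit_of_subs h.1 h.2⟩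

end ParitySplit

end Summit.Langlands.Langlands.Theorems.QuarterFingerprintDeficit

end
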